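import Mathlib
import Summits.CriticalPhenomena.PercolationContinuityZ3.Theorems.PercNearOneGluingNoHeavyLowerTailReciprocalCM
import Summits.CriticalPhenomena.PercolationContinuityZ3.Theorems.PercNearOneGluingNoHeavyLowerTailHypergeomSums
import HarnessLib

/-!
# THEOREM H: `1/₂F₁(-θ, -r; c; g)` is a completely monotone sequence — and TP_∞ of THEOREM N's class with a Y-neutral copy

Support file for the Sahi / Conjecture-P programme of route `PercNearOneGluingNoHeavy`
(`--supports stmt-CriticalPhenomena-4575`, prover prim-l12-p5 gen 36; proof note
`prim-l12-p5/PROOF-THEOREM-H-g36.md` §1, §3, §4).  No definitions, no named facts, no sorries.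

**THEOREM H (discrete form; `hyp_inv_altSum_nonneg`, `hypergeom_inv_cm`).**  For real `θ > 0`, `c ≥ 1`,
`0 ≤ g < 1`, the sequence `r ↦ 1/₂F₁(-θ, -r; c; g)` (reciprocal of a finite Gauss sum) is completely
monotone: all Hausdorff differences `Σ_{i≤k} (-1)^i C(k,i) φ_{j+i}` are `≥ 0`, i.e. it is a Hausdorff moment
sequence.  Proof (memo §3.7): induction on `⌈θ⌉`.  For `θ₀ ∈ (0,1]`, `P_{θ₀} = ₂F₁(-θ₀,-·;c;g)` is a positive
sequence with completely monotone first difference (a Beta mixture, `hyp_altSum_nonneg`), so `1/P_{θ₀}` is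
CM by LEMMA DB (`altSum_inv_nonneg`); Gauss' contiguous relation (`hyp_gauss`) writes
`R_{ϑ+1} = P_{ϑ+1}/P_ϑ` as `affine(r) - ϑ(1-g)/(c+ϑ) · P_{ϑ-1}/P_ϑ`, whose first difference is CM when
`P_{ϑ-1}/P_ϑ` is; LEMMA DB again gives `P_ϑ/P_{ϑ+1}` CM, and `1/P_{ϑ+1} = (1/P_ϑ)(P_ϑ/P_{ϑ+1})` (Leibniz).
For non-integer `θ` the function `x ↦ ₂F₁(-θ,-x;c;g)` has non-real zeros (memo §5), so no
real-rootedness proof exists; for integer `θ` this is the Meixner case of g35.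

**COROLLARY (`lPlusC_div_factorial_tn_of_hyp`) = THEOREM N⁺ in matrix form.**  If `c_n > 0` and
`r!/∏_{m≤r}(m+c_m) = ρ^r · ∏_{m<r}(1+m)/(γ+1+m) · 1/₂F₁(-θ,-r;γ+1;g)` with `0 < ρ ≤ 1`, `γ > 0`, `θ > 0`,
`0 ≤ g < 1`, then `[(l+c_n)/(n-l)!]_{l≤n}` is totally nonnegative (THEOREM W♯(⟸) of
`…LowerTailMomentRatioTN`).  By memo §1 (identity (1.4)) this is exactly the W♯ moment sequence of the smoothed
`x`-Laplace kernel of `F_s` for `Ψ = (1+p_A u+v)(1+p_B u+q_B v)^θ` (`q_A = 1`, `ρ = 1-λ_A/λ_B`, `γ = s+1`,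
`g = g_B`), so `F_s` is TP_∞ for every real `θ > 0` — g34's THEOREM N2 upgraded from TP₂ to TP_∞ when the
integer copy is Y-neutral.
-/

namespace Summit.CriticalPhenomena.PercolationContinuityZ3.Theorems

namespace HypergeomCM

open Finset MomentRatioTN
open scoped Nat

/-- Linearity helper: `D_k (K · u)(j) = K · D_k u (j)`. -/
theorem altSum_const_mul (K : ℝ) (u : ℕ → ℝ) (k j : ℕ) :
    ∑ i ∈ range (k + 1), (-1 : ℝ) ^ i * (k.choose i : ℝ) * (K * u (j + i)) =
      K * ∑ i ∈ range (k + 1), (-1 : ℝ) ^ i * (k.choose i : ℝ) * u (j + i) := by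
  rw [mul_sum]
  exact sum_congr rfl fun i _ => by ring

/-- Linearity helper: `D_k (A + B · u)(j) = A · 1^j (1-1)^k + B · D_k u (j)`. -/
theorem altSum_const_add_mul (A B : ℝ) (u : ℕ → ℝ) (k j : ℕ) :
    ∑ i ∈ range (k + 1), (-1 : ℝ) ^ i * (k.choose i : ℝ) * (A + B * u (j + i)) =
      A * ((1 : ℝ) ^ j * (1 - 1) ^ k) + B * ∑ i ∈ range (k + 1), (-1 : ℝ) ^ i * (k.choose i : ℝ) * u (j + i) := by
  rw [← altSum_geom 1 k j, mul_sum, mul_sum, ← sum_add_distrib]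
  exact sum_congr rfl fun i _ => by ring

section

variable (g : ℝ) (H : ℝ → ℝ → ℕ → ℝ)
  (hH : ∀ a c r, H a c r = ∑ k ∈ range (r + 1), (r.choose k : ℝ) * (-g) ^ k *
    ((∏ i ∈ range k, (a + i)) / (∏ i ∈ range k, (c + i))))
include hH

/-- The induction behind THEOREM H (memo §3.7): for `θ₀ ∈ (0,1]` and every `n`, both `1/P_{θ₀+n}` and
`P_{θ₀+n-1}/P_{θ₀+n}` are completely monotone sequences (`P_ϑ r = H (-ϑ) c r = ₂F₁(-ϑ,-r;c;g)`). -/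
theorem hyp_inv_altSum_aux (hg0 : 0 ≤ g) (hg1 : g < 1) (c : ℝ) (hc : 1 ≤ c) (θ₀ : ℝ) (h0 : 0 < θ₀)
    (h1 : θ₀ ≤ 1) : ∀ n : ℕ,
      (∀ k j, 0 ≤ ∑ i ∈ range (k + 1), (-1 : ℝ) ^ i * (k.choose i : ℝ) * (H (-(θ₀ + n)) c (j + i))⁻¹) ∧
      (∀ k j, 0 ≤ ∑ i ∈ range (k + 1), (-1 : ℝ) ^ i * (k.choose i : ℝ) *
        (H (1 - (θ₀ + n)) c (j + i) * (H (-(θ₀ + n)) c (j + i))⁻¹)) := by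
  have hc0 : 0 < c := by linarith
  have hPpos : ∀ ϑ : ℝ, 0 ≤ ϑ → ∀ r, 0 < H (-ϑ) c r :=
    fun ϑ hϑ r => hyp_pos g H hH hg0 hg1 (-ϑ) r c hc0 (by linarith)
  intro n
  induction n with
  | zero =>
    simp only [Nat.cast_zero, add_zero]
    have hΔ : ∀ r, H (-θ₀) c (r + 1) - H (-θ₀) c r = θ₀ * g / c * H (1 - θ₀) (c + 1) r := by
      intro r
      have hs := hyp_step g H hH (-θ₀) c hc0 r
      rw [show -θ₀ + 1 = 1 - θ₀ by ring] at hs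
      field_simp
      linear_combination hs
    have hinv : ∀ k j, 0 ≤ ∑ i ∈ range (k + 1), (-1 : ℝ) ^ i * (k.choose i : ℝ) *
        (H (-θ₀) c (j + i))⁻¹ := by
      refine altSum_inv_nonneg (fun r => H (-θ₀) c r) (hPpos θ₀ h0.le) fun k j => ?_
      simp_rw [hΔ]
      rw [altSum_const_mul]
      exact mul_nonneg (div_nonneg (mul_nonneg h0.le hg0) hc0.le)
        (hyp_altSum_nonneg g H hH hg0 hg1 (1 - θ₀) (c + 1) (by linarith) (by linarith) (by linarith) k j)
    refine ⟨hinv, fun k j => ?_⟩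
    exact altSum_mul_nonneg (fun r => H (1 - θ₀) c r) (fun r => (H (-θ₀) c r)⁻¹)
      (hyp_altSum_nonneg g H hH hg0 hg1 (1 - θ₀) c (by linarith) (by linarith) hc0) hinv k j
  | succ n ih =>
    obtain ⟨ihA, ihB⟩ := ih
    have e1 : -(θ₀ + ((n + 1 : ℕ) : ℝ)) = -(θ₀ + n) - 1 := by push_cast; ring
    have e2 : (1 : ℝ) - (θ₀ + ((n + 1 : ℕ) : ℝ)) = -(θ₀ + n) := by push_cast; ring
    simp only [e1, e2]
    set ϑ : ℝ := θ₀ + (n : ℝ) with hϑdef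
    have hϑ0 : 0 < ϑ := by rw [hϑdef]; positivity
    have hcϑ : 0 < c + ϑ := by linarith
    have hP0 : ∀ r, 0 < H (-ϑ) c r := hPpos ϑ hϑ0.le
    have hP1 : ∀ r, 0 < H (-ϑ - 1) c r := fun r => by
      have := hPpos (ϑ + 1) (by linarith) r
      rwa [show -(ϑ + 1) = -ϑ - 1 by ring] at this
    -- Gauss: (c+ϑ) P_{ϑ+1} = (2ϑ + c + (r-ϑ)g) P_ϑ - ϑ(1-g) P_{ϑ-1}; R := P_{ϑ+1}/P_ϑ
    have hR : ∀ r : ℕ, H (-ϑ - 1) c r * (H (-ϑ) c r)⁻¹ =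
        ((2 * ϑ + c + ((r : ℝ) - ϑ) * g) - ϑ * (1 - g) * (H (1 - ϑ) c r * (H (-ϑ) c r)⁻¹)) / (c + ϑ) := by
      intro r
      have hg' := hyp_gauss g H hH r (-ϑ) c hc0
      rw [show -ϑ + 1 = 1 - ϑ by ring] at hg'
      have h0 := (hP0 r).ne'
      have hcϑ' := hcϑ.ne'
      field_simp
      linear_combination hg'
    have hΔR : ∀ r : ℕ, H (-ϑ - 1) c (r + 1) * (H (-ϑ) c (r + 1))⁻¹ - H (-ϑ - 1) c r * (H (-ϑ) c r)⁻¹ =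
        g / (c + ϑ) + ϑ * (1 - g) / (c + ϑ) *
          (H (1 - ϑ) c r * (H (-ϑ) c r)⁻¹ - H (1 - ϑ) c (r + 1) * (H (-ϑ) c (r + 1))⁻¹) := by
      intro r
      rw [hR (r + 1), hR r]
      have hcϑ' := hcϑ.ne'
      push_cast
      field_simp
      ring
    -- the first difference of R is completely monotone
    have hΔR_cm : ∀ k j, 0 ≤ ∑ i ∈ range (k + 1), (-1 : ℝ) ^ i * (k.choose i : ℝ) *
        (H (-ϑ - 1) c (j + i + 1) * (H (-ϑ) c (j + i + 1))⁻¹ - H (-ϑ - 1) c (j + i) * (H (-ϑ) c (j + i))⁻¹) := by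
      intro k j
      simp_rw [hΔR]
      rw [altSum_const_add_mul (g / (c + ϑ)) (ϑ * (1 - g) / (c + ϑ))
        (fun r => H (1 - ϑ) c r * (H (-ϑ) c r)⁻¹ - H (1 - ϑ) c (r + 1) * (H (-ϑ) c (r + 1))⁻¹) k j]
      have hk : ∑ i ∈ range (k + 1), (-1 : ℝ) ^ i * (k.choose i : ℝ) *
          (H (1 - ϑ) c (j + i) * (H (-ϑ) c (j + i))⁻¹ - H (1 - ϑ) c (j + i + 1) * (H (-ϑ) c (j + i + 1))⁻¹) =
          ∑ i ∈ range (k + 2), (-1 : ℝ) ^ i * ((k + 1).choose i : ℝ) *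
            (H (1 - ϑ) c (j + i) * (H (-ϑ) c (j + i))⁻¹) :=
        (altSum_succ (fun r => H (1 - ϑ) c r * (H (-ϑ) c r)⁻¹) k j).symm
      rw [hk]
      have hB := ihB (k + 1) j
      have : (0 : ℝ) ≤ (1 - 1) ^ k := pow_nonneg (by norm_num) k
      have hA : 0 ≤ g / (c + ϑ) := div_nonneg hg0 hcϑ.le
      have hB0 : 0 ≤ ϑ * (1 - g) / (c + ϑ) := div_nonneg (mul_nonneg hϑ0.le (by linarith)) hcϑ.le
      positivity
    -- LEMMA DB: 1/R = P_ϑ/P_{ϑ+1} is completely monotone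
    have hRinv : ∀ k j, 0 ≤ ∑ i ∈ range (k + 1), (-1 : ℝ) ^ i * (k.choose i : ℝ) *
        (H (-ϑ) c (j + i) * (H (-ϑ - 1) c (j + i))⁻¹) := by
      intro k j
      have := altSum_inv_nonneg (fun r => H (-ϑ - 1) c r * (H (-ϑ) c r)⁻¹)
        (fun r => mul_pos (hP1 r) (inv_pos.2 (hP0 r))) hΔR_cm k j
      simpa only [mul_inv_rev, inv_inv] using this
    refine ⟨fun k j => ?_, hRinv⟩
    -- 1/P_{ϑ+1} = (1/P_ϑ) · (P_ϑ/P_{ϑ+1})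
    have e : ∀ r, (H (-ϑ - 1) c r)⁻¹ = (H (-ϑ) c r)⁻¹ * (H (-ϑ) c r * (H (-ϑ - 1) c r)⁻¹) := by
      intro r
      have h0 := (hP0 r).ne'
      field_simp
    have hsum : (∑ i ∈ range (k + 1), (-1 : ℝ) ^ i * (k.choose i : ℝ) * (H (-ϑ - 1) c (j + i))⁻¹) =
        ∑ i ∈ range (k + 1), (-1 : ℝ) ^ i * (k.choose i : ℝ) *
          ((H (-ϑ) c (j + i))⁻¹ * (H (-ϑ) c (j + i) * (H (-ϑ - 1) c (j + i))⁻¹)) :=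
      sum_congr rfl fun i _ => by rw [← e (j + i)]
    rw [hsum]
    exact altSum_mul_nonneg (fun r => (H (-ϑ) c r)⁻¹) (fun r => H (-ϑ) c r * (H (-ϑ - 1) c r)⁻¹)
      ihA hRinv k j

/-- **THEOREM H (discrete form).**  For `θ > 0`, `c ≥ 1`, `0 ≤ g < 1`: the sequence
`r ↦ 1/H(-θ) c r = 1/₂F₁(-θ,-r;c;g)` is completely monotone (a Hausdorff moment sequence). -/
theorem hyp_inv_altSum_nonneg (hg0 : 0 ≤ g) (hg1 : g < 1) (c : ℝ) (hc : 1 ≤ c) (θ : ℝ) (hθ : 0 < θ)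
    (k j : ℕ) : 0 ≤ ∑ i ∈ range (k + 1), (-1 : ℝ) ^ i * (k.choose i : ℝ) * (H (-θ) c (j + i))⁻¹ := by
  -- θ = θ₀ + n with θ₀ ∈ (0,1]
  have hceil : 1 ≤ ⌈θ⌉₊ := Nat.one_le_iff_ne_zero.2 (Nat.pos_iff_ne_zero.1 (Nat.ceil_pos.2 hθ))
  obtain ⟨n, hn1, hn2⟩ : ∃ n : ℕ, (n : ℝ) < θ ∧ θ ≤ n + 1 := by
    refine ⟨⌈θ⌉₊ - 1, ?_, ?_⟩
    · have h1 := Nat.ceil_lt_add_one hθ.le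
      rw [Nat.cast_sub hceil, Nat.cast_one]
      linarith
    · have h2 := Nat.le_ceil θ
      rw [Nat.cast_sub hceil, Nat.cast_one]
      linarith
  have haux := (hyp_inv_altSum_aux g H hH hg0 hg1 c hc (θ - n) (by linarith) (by linarith) n).1 k j
  simpa only [sub_add_cancel] using haux

/-- THEOREM H also gives: `r ↦ ₂F₁(1-θ,-r;c;g)/₂F₁(-θ,-r;c;g)` is completely monotone (`θ > 0`, `c ≥ 1`,
`0 ≤ g < 1`). -/
theorem hyp_ratio_altSum_nonneg (hg0 : 0 ≤ g) (hg1 : g < 1) (c : ℝ) (hc : 1 ≤ c) (θ : ℝ) (hθ : 0 < θ)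
    (k j : ℕ) : 0 ≤ ∑ i ∈ range (k + 1), (-1 : ℝ) ^ i * (k.choose i : ℝ) *
      (H (1 - θ) c (j + i) * (H (-θ) c (j + i))⁻¹) := by
  have hceil : 1 ≤ ⌈θ⌉₊ := Nat.one_le_iff_ne_zero.2 (Nat.pos_iff_ne_zero.1 (Nat.ceil_pos.2 hθ))
  obtain ⟨n, hn1, hn2⟩ : ∃ n : ℕ, (n : ℝ) < θ ∧ θ ≤ n + 1 := by
    refine ⟨⌈θ⌉₊ - 1, ?_, ?_⟩
    · have h1 := Nat.ceil_lt_add_one hθ.le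
      rw [Nat.cast_sub hceil, Nat.cast_one]
      linarith
    · have h2 := Nat.le_ceil θ
      rw [Nat.cast_sub hceil, Nat.cast_one]
      linarith
  have haux := (hyp_inv_altSum_aux g H hH hg0 hg1 c hc (θ - n) (by linarith) (by linarith) n).2 k j
  simpa only [sub_add_cancel] using haux

end

/-- **THEOREM H, closed form.**  For `θ > 0`, `c ≥ 1`, `0 ≤ g < 1` the reciprocals
`φ_r = 1/₂F₁(-θ,-r;c;g) = 1/Σ_{l≤r} C(r,l)(-g)^l ∏_{m<l}(-θ+m)/∏_{m<l}(c+m)` form a completely monotone sequence: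
`Σ_{i≤k} (-1)^i C(k,i) φ_{j+i} ≥ 0` for all `j, k`. -/
theorem hypergeom_inv_cm (g θ c : ℝ) (hg0 : 0 ≤ g) (hg1 : g < 1) (hc : 1 ≤ c) (hθ : 0 < θ) (k j : ℕ) :
    0 ≤ ∑ i ∈ range (k + 1), (-1 : ℝ) ^ i * (k.choose i : ℝ) *
      (∑ l ∈ range (j + i + 1), ((j + i).choose l : ℝ) * (-g) ^ l *
        ((∏ m ∈ range l, (-θ + m)) / (∏ m ∈ range l, (c + m))))⁻¹ :=
  hyp_inv_altSum_nonneg g (fun a c r => ∑ l ∈ range (r + 1), (r.choose l : ℝ) * (-g) ^ l *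
    ((∏ m ∈ range l, (a + m)) / (∏ m ∈ range l, (c + m)))) (fun _ _ _ => rfl) hg0 hg1 c hc θ hθ k j

/-- **THEOREM N⁺ (matrix form; memo §1 (1.4), §4).**  Let `θ > 0`, `γ > 0`, `0 ≤ g < 1`, `0 < ρ ≤ 1`, and let
`c_n > 0` satisfy `r!/∏_{m≤r}(m + c_m) = ρ^r · ∏_{m<r} (1+m)/(γ+1+m) · 1/₂F₁(-θ,-r;γ+1;g)` for all `r`
(the W♯ moment sequence of the smoothed `x`-Laplace kernel of `F_s` for `Ψ = (1+p_A u+v)(1+p_B u+q_B v)^θ`,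
`γ = s+1`, `g = g_B`, `ρ = 1 - λ_A/λ_B`).  Then `[(l + c_n)/(n-l)!]_{l ≤ n}` is totally nonnegative; hence
(PROOF-TWO-RAY (0.5)) `F_s` is TP_∞ for every real `θ`. -/
theorem lPlusC_div_factorial_tn_of_hyp (θ γ g ρ : ℝ) (hθ : 0 < θ) (hγ : 0 < γ) (hg0 : 0 ≤ g) (hg1 : g < 1)
    (hρ0 : 0 < ρ) (hρ1 : ρ ≤ 1) (c : ℕ → ℝ) (hc : ∀ n, 0 < c n)
    (hμ : ∀ r : ℕ, ((r ! : ℕ) : ℝ) / ∏ m ∈ range r, ((m : ℝ) + 1 + c (m + 1)) =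
      ρ ^ r * (∏ m ∈ range r, ((1 : ℝ) + m) / (γ + 1 + m)) *
        (∑ l ∈ range (r + 1), (r.choose l : ℝ) * (-g) ^ l *
          ((∏ m ∈ range l, (-θ + m)) / (∏ m ∈ range l, (γ + 1 + m))))⁻¹)
    {k : ℕ} (r c' : Fin k → ℕ) (hr : StrictMono r) (hc' : StrictMono c') :
    0 ≤ (Matrix.of fun i j =>
      if c' j ≤ r i then ((c' j : ℝ) + c (r i)) / ((r i - c' j)! : ℕ) else 0).det := by
  set P : ℝ → ℝ → ℕ → ℝ := fun a c r => ∑ l ∈ range (r + 1), (r.choose l : ℝ) * (-g) ^ l *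
    ((∏ m ∈ range l, (a + m)) / (∏ m ∈ range l, (c + m))) with hPdef
  have hP : ∀ a c r, P a c r = ∑ l ∈ range (r + 1), (r.choose l : ℝ) * (-g) ^ l *
    ((∏ m ∈ range l, (a + m)) / (∏ m ∈ range l, (c + m))) := fun _ _ _ => rfl
  have hPpos : ∀ r, 0 < P (-θ) (γ + 1) r :=
    fun r => hyp_pos g P hP hg0 hg1 (-θ) r (γ + 1) (by linarith) (by linarith)
  refine MomentRatioTN.lPlusC_div_factorial_tn c hc (fun k j => ?_) r c' hr hc'
  have hμ' : ∀ r : ℕ, ((r ! : ℕ) : ℝ) / ∏ m ∈ range r, ((m : ℝ) + 1 + c (m + 1)) =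
      (ρ ^ r * (P (-θ) (γ + 1) r)⁻¹) * ∏ m ∈ range r, ((1 : ℝ) + m) / (γ + 1 + m) := by
    intro r; rw [hμ r]; ring
  simp only [hμ']
  refine altSum_mul_pos_of_pos (fun r => ρ ^ r * (P (-θ) (γ + 1) r)⁻¹)
    (fun r => ∏ m ∈ range r, ((1 : ℝ) + m) / (γ + 1 + m)) (fun r => mul_pos (pow_pos hρ0 r) (inv_pos.2 (hPpos r)))
    (fun k j => ?_) (fun k j => altSum_pochRatio_pos 1 (γ + 1) one_pos (by linarith) k j) k j
  exact altSum_mul_nonneg (fun r => ρ ^ r) (fun r => (P (-θ) (γ + 1) r)⁻¹) (altSum_geom_nonneg ρ hρ0.le hρ1)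
    (hyp_inv_altSum_nonneg g P hP hg0 hg1 (γ + 1) (by linarith) θ hθ) k j

end HypergeomCM

end Summit.CriticalPhenomena.PercolationContinuityZ3.Theorems
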